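/-
Origin: expansion seat `planner-pub-hodgecm-pv02-g6-0`, handover #1 v2 2026-08-18T10:07:34Z doc-only (`HOME/pub-hodgecm-pv02-g6/lean/Pv02g6/ArchAWeilKFinite.lean`, md5 ba9ea833, 245 lines);
landed by the gen-7 packager in gate run 28 REPLACES the earlier landed copy of `HodgeCM/PerL34/ArchAWeilKFinite.lean` (import ^import Pv[0-9]+g[0-9]+\.→import HodgeCM.PerL34. ×1).
-/
/-
Origin: HOME/pub-hodgecm-pv02-g6/lean/Pv02g6/ArchAWeilKFinite.lean (module `Pv02g6.ArchAWeilKFinite`; the packager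
renames to `HodgeCM.PerL34.ArchAWeilKFinite` and rewrites `import Pv02g5.ArchAWeilFinite` ↦
`import HodgeCM.PerL34.ArchAWeilFinite`) — session planner-pub-hodgecm-pv02-g6-0 (unit pub-hodgecm-pv02-g6,
DAG-NODE PROVER #02 gen 6).
DAG node (HOME/LEMMAS.md v14 §1): N27 = PerL v5 Lemma 4.1(a) `lem:arch` (tex ll. 480–482, pf 493–496; set-up
ll. 262–268, 341, 470–478) — the DEFINITIONAL residual `OrbitFinite` of N27 over the Weil theta model (pv02-g5
`ArchAWeilFinite`, run 27) BUILT INTO THE CARRIER, as print does for everything L4.1(a) is applied to (the theta space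
of ll. 265–268 is spanned by lifts of Fock = `K`-finite vectors).
Imports: pv02-g5 `ArchAWeilFinite` (HANDOVER #2 7cbe09e75ed3, run 27) only.
v2 (DOC-ONLY, adv2g22-C57): the warrant for the `K`-finite reading is ll. 265–268 (+ l. 341), not l. 264 alone — see
the module docstring; Lean code byte-identical to v1 c2fcd0bf5397.
-/
import Summits.HodgeConjecture.HodgeCM.PerL34.ArchAWeilFinite

/-!
# The `U(W_{i,b})`-finite part of a Weil theta model; N27 over it with no finiteness hypothesis

PerL v5 ll. 262–264, VERBATIM: "let $\omega_{W,\mu}=\omega_{\psi,\chi_V,\mu}$ be the Weil representation of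
$\U(W)(\A)\times G_U(\A)$ on $\cS((V_3\otimes W)(\A))$ (Schwartz--Bruhat functions; at the archimedean place we use
the Fock (polynomial) model, i.e.\ $K$-finite vectors)"; ll. 265–268, VERBATIM: "put
$\theta(\phi,\chi'):=\int_{[\U(W)]}\theta_\phi(\cdot,u)\chi'(u)\,du$ and let $\Theta^W_\mu(\chi')$ denote the space of
these functions ($\phi$ varying), a $(\fg,K_\infty)\times G_U(\A_f)$-module of $K$-finite automorphic forms on $[G_U]$
(the \emph{theta space} …)"; l. 476: "$\U(W_{i,b})=\U(1)$ acts on it by a character $u\mapsto u^{-e_b(\Psi_i)}$".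
WARRANT (v2, adv2g22-C57).  From l. 341 on, print's `𝒮` is the FULL Schwartz–Bruhat space and `𝒮^κ ⊆ 𝒮` — prl1-g4's
field `SK` of `HodgeCM.WeilThetaModel` ("DEF (PerL l. 341): the index space `𝒮^κ ⊆ S(X_A)`") — is NOT `K_∞`-finite by
definition (L4.1(c) uses all of it).  What justifies reading L4.1(a) on `K`-finite vectors is ll. 265–268: the theta
space `Θ^W_μ(χ')` is BY DEFINITION spanned by the lifts `θ(φ,χ')` of Fock (= `K`-finite, l. 264) vectors `φ` and is "a
module of `K`-finite automorphic forms", and every consumer of L4.1(a) in print (L4.2(b) ll. 529–532 / 631–635 = N31,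
P4.3 ll. 650–657 = N33b) applies it to such `φ`; a `K_∞`-finite `φ` is in particular finite under each compact
one-place circle `U(W_{i,b}) = U(1) ⊆ K_∞`, which is all this file uses.

pv02-g5 (`HodgeCM.PerL34.ArchAWeilFinite`, run 27) proved N27 over ANY Weil theta model `M` of a hermitian line
modulo exactly this finiteness: `ArchAWeil.N27_ofWeilModel_finite (hι : ∀ b, Continuous (ι b))
(hfin : OrbitFinite M ι) : (lineData M ι₁ ι kJ).N27_statement`, where `OrbitFinite M ι` := for every `Φ ∈ 𝒮^κ`
and every real place `b` the kernels `θ_{ω(ι_b u)Φ}`, `u ∈ U(1)`, span a finite-dimensional space.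

THIS FILE removes that hypothesis by building it into the carrier:

* `WeilThetaModel.finiteSK M ι ⊆ M.SK` — the `Φ ∈ 𝒮^κ` whose `U(W_{i,b})`-orbits span finite-dimensional kernel
  spaces at every real place `b` (`mem_finiteSK_iff`);
* **`WeilThetaModel.kFinite M ι : WeilThetaModel GU ΓU G Γ`** — the SAME Weil / theta data (`W`, `act`, `theta`,
  `s`, every PRINT-BY-NAME field of prl1-g4's structure UNTOUCHED: `kFinite_W`, `kFinite_s`) with index space
  `finiteSK M ι`.  The one thing to prove is the stability field `SK_stable`: `ω(h)`, `h ∈ U(W_i)(𝔸)`, preserves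
  finiteness — because `U(W_i)(𝔸)` is COMMUTATIVE, `θ_{ω(ι_b u) ω(h) Φ} = T_h θ_{ω(ι_b u) Φ}` (`ArchAWeil.transl_θ`,
  `transl_mul`), so the orbit span of `ω(h)Φ` is the image of that of `Φ` under the linear map `T_h`
  (**`ArchAWeil.orbitSpan_omg`**), hence finite-dimensional with it;
* **`ArchAWeil.orbitFinite_kFinite : OrbitFinite (M.kFinite ι) ι`** — by construction (`orbitSpan_kFinite`: the
  orbit spans of the sub-model are those of `M`, `rfl`);
* `finiteSK_eq_of_orbitFinite : OrbitFinite M ι → finiteSK M ι = M.SK` — the construction is the identity on a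
  model that is already finite (e.g. pv14-g4's CONSTRUCTED Schrödinger–lattice model, by pv02-g5 #4
  `orbitFinite_schrodinger`), and `finiteSK M ι` is the LARGEST `ω`-stable finite part (`finiteSK_maximal`);
* **`ArchAWeil.N27_kFinite (hι : ∀ b, Continuous (ι b)) : (lineData (M.kFinite ι) ι₁ ι kJ).N27_statement`** —
  PerL v5 Lemma 4.1(a), pv02's verbatim rendering `ArchA.LineArchData.N27_statement`, over the `K`-finite part of
  ANY Weil theta model of a hermitian line, with the continuity of the real-place circles `ι_b` as the ONLY
  remaining (set-up) hypothesis — discharged for PerL's GENUINE torus `U(W_i)(𝔸) = U(1)_{L/L⁺}(𝔸_{L⁺})` in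
  `ArchAWeilGenuine` (this seat, next file).

NET EFFECT on the N27 row (LEMMAS v14: "Residual of N27 in the cell: the adelic theta MODEL itself — an instance of
`WeilThetaModel` for PerL's U(2,1) × U(W_i) with `OrbitFinite`"): the qualifier "with `OrbitFinite`" is dropped —
ANY instance `M` yields N27 on `M.kFinite ι`, whose index space `finiteSK M ι` contains every `K_∞`-finite (Fock)
vector of `𝒮^κ` — i.e. every `φ` over which the theta space of ll. 265–268 is spanned, which is everything L4.1(a) is
applied to in print (v2 wording; v1 said "`𝒮^κ ∩ {K-finite}` = `𝒮^κ` (l. 264)", superseded by l. 341, adv2g22-C57).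

VACUITY NOTE.  `finiteSK M ι` may be a proper subset of `M.SK` (it is empty iff `M.SK` is: it contains every
`U(W_{i,b})`-finite vector, and it is ALL of `M.SK` whenever `OrbitFinite M ι`, `finiteSK_eq_of_orbitFinite` — so
over the constructed Schrödinger–lattice model the premises of N27 stay inhabited, pv02-g5 #4
`N27_premises_inhabited`).  No statement of N27 / PerL / QW8 / the 2001 programme is a hypothesis anywhere in this
file; nothing is cited; no new data is posited (the sub-model is CONSTRUCTED from `M`).
-/

set_option autoImplicit false

noncomputable section

open Topology

namespace HodgeCM

/-! ## §1  The orbit span of `ω(h)Φ` is the `T_h`-image of the orbit span of `Φ` -/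

namespace PerL34
namespace ArchAWeil

variable {GU : Type} [Group GU] [TopologicalSpace GU] [IsTopologicalGroup GU] {ΓU : Subgroup GU}
variable {G : Type} [CommGroup G] [TopologicalSpace G] [IsTopologicalGroup G] {Γ : Subgroup G}
variable (M : WeilThetaModel GU ΓU G Γ) {RealPl : Type} (ι : RealPl → (Circle →* G))

/-- `θ_{ω(ι_b u) ω(h) Φ} = T_h θ_{ω(ι_b u) Φ}` — `U(W_i)(𝔸)` is commutative and `Φ ↦ θ_Φ` is `ω ↦ T`-equivariant
(`transl_θ`, prl1-g4's `θ_omg`). -/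
theorem θ_omg_omg_comm (b : RealPl) (u : Circle) (h : G) (Φ : M.SK) :
    M.θ (M.omg (ι b u) (M.omg h Φ)) = transl h (M.θ (M.omg (ι b u) Φ)) := by
  rw [← transl_θ, ← transl_θ, ← transl_θ, ← transl_mul, ← transl_mul, mul_comm]

/-- **The `U(W_{i,b})`-orbit span of `ω(h)Φ` is the image of that of `Φ` under the linear map `T_h`.** -/
theorem orbitSpan_omg (b : RealPl) (h : G) (Φ : M.SK) :
    orbitSpan M ι b (M.omg h Φ) = (orbitSpan M ι b Φ).map (transl h) := by
  have hcomp : (fun u : Circle => M.θ (M.omg (ι b u) (M.omg h Φ))) =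
      ⇑(transl (ΓU := ΓU) (Γ := Γ) h) ∘ fun u : Circle => M.θ (M.omg (ι b u) Φ) := by
    funext u
    exact θ_omg_omg_comm M ι b u h Φ
  rw [orbitSpan, orbitSpan, hcomp, Set.range_comp, Submodule.map_span]

/-- Hence `ω(h)` preserves `U(W_{i,b})`-finiteness. -/
theorem finiteDimensional_orbitSpan_omg (b : RealPl) (h : G) (Φ : M.SK)
    [FiniteDimensional ℂ (orbitSpan M ι b Φ)] : FiniteDimensional ℂ (orbitSpan M ι b (M.omg h Φ)) := by
  rw [orbitSpan_omg]
  infer_instance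

end ArchAWeil
end PerL34

/-! ## §2  The `K`-finite sub-model -/

namespace WeilThetaModel

open PerL34 PerL34.ArchAWeil

variable {GU : Type} [Group GU] [TopologicalSpace GU] [IsTopologicalGroup GU] {ΓU : Subgroup GU}
variable {G : Type} [CommGroup G] [TopologicalSpace G] [IsTopologicalGroup G] {Γ : Subgroup G}
variable (M : WeilThetaModel GU ΓU G Γ) {RealPl : Type} (ι : RealPl → (Circle →* G))

/-- **The `U(W_{i,b})`-finite vectors of `𝒮^κ`** (all real places `b`): `Φ ∈ 𝒮^κ` whose kernel orbit
`{θ_{ω(ι_b u)Φ} : u ∈ U(1)}` spans a finite-dimensional space for every `b` — PerL's "K-finite vectors" (l. 264;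
the vectors spanning the theta space of ll. 265–268) read on kernels, place by place. -/
def finiteSK : Set M.W.SX :=
  {Φ | Φ ∈ M.SK ∧ ∀ (hΦ : Φ ∈ M.SK) (b : RealPl), FiniteDimensional ℂ (orbitSpan M ι b ⟨Φ, hΦ⟩)}

/-- (Ported verbatim from the HodgeCMPerL package; no docstring in the source.) -/
theorem finiteSK_subset : M.finiteSK ι ⊆ M.SK := fun _ h => h.1

/-- (Ported verbatim from the HodgeCMPerL package; no docstring in the source.) -/
theorem mem_finiteSK_iff (Φ : M.SK) :
    (Φ : M.W.SX) ∈ M.finiteSK ι ↔ ∀ b, FiniteDimensional ℂ (orbitSpan M ι b Φ) :=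
  ⟨fun h b => h.2 Φ.2 b, fun h => ⟨Φ.2, fun _ b => h b⟩⟩

/-- (Ported verbatim from the HodgeCMPerL package; no docstring in the source.) -/
theorem mem_finiteSK {Φ : M.W.SX} (hΦ : Φ ∈ M.SK) (h : ∀ b, FiniteDimensional ℂ (orbitSpan M ι b ⟨Φ, hΦ⟩)) :
    Φ ∈ M.finiteSK ι :=
  (M.mem_finiteSK_iff ι ⟨Φ, hΦ⟩).mpr h

/-- `ω(h)`, `h ∈ U(W_i)(𝔸)`, preserves the `K`-finite vectors (§1). -/
theorem omg_mem_finiteSK (h : G) (Φ : M.SK) (hΦ : (Φ : M.W.SX) ∈ M.finiteSK ι) :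
    (M.omg h Φ : M.W.SX) ∈ M.finiteSK ι := by
  rw [mem_finiteSK_iff] at hΦ ⊢
  intro b
  haveI := hΦ b
  exact finiteDimensional_orbitSpan_omg M ι b h Φ

/-- **The `K`-finite sub-model `M.kFinite ι`**: the same Weil representation / theta functional / dual-pair
splitting (`W`, `s` and every print-by-name field of `M` verbatim), with index space the `U(W_{i,b})`-finite
vectors of `𝒮^κ`.  CONSTRUCTED; the only proof obligation is `SK_stable` (= `omg_mem_finiteSK`). -/
def kFinite : WeilThetaModel GU ΓU G Γ :=
  { M with
    SK := M.finiteSK ι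
    SK_stable := fun h Φ hΦ => M.omg_mem_finiteSK ι h ⟨Φ, hΦ.1⟩ hΦ }

/-- (Ported verbatim from the HodgeCMPerL package; no docstring in the source.) -/
@[simp] theorem kFinite_W : (M.kFinite ι).W = M.W := rfl

/-- (Ported verbatim from the HodgeCMPerL package; no docstring in the source.) -/
@[simp] theorem kFinite_s : (M.kFinite ι).s = M.s := rfl

/-- (Ported verbatim from the HodgeCMPerL package; no docstring in the source.) -/
theorem kFinite_SK : (M.kFinite ι).SK = M.finiteSK ι := rfl

/-- (Ported verbatim from the HodgeCMPerL package; no docstring in the source.) -/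
theorem kFinite_SK_subset : (M.kFinite ι).SK ⊆ M.SK := M.finiteSK_subset ι

/-- The inclusion of index spaces `(M.kFinite ι).SK → M.SK`. -/
def kFiniteIncl (Φ : (M.kFinite ι).SK) : M.SK := ⟨Φ.1, Φ.2.1⟩

/-- (Ported verbatim from the HodgeCMPerL package; no docstring in the source.) -/
@[simp] theorem coe_kFiniteIncl (Φ : (M.kFinite ι).SK) : (M.kFiniteIncl ι Φ : M.W.SX) = Φ.1 := rfl

/-- (Ported verbatim from the HodgeCMPerL package; no docstring in the source.) -/
theorem kFiniteIncl_injective : Function.Injective (M.kFiniteIncl ι) := fun Φ Ψ h => by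
  have hval : (M.kFiniteIncl ι Φ : M.W.SX) = (M.kFiniteIncl ι Ψ : M.W.SX) := congrArg Subtype.val h
  exact Subtype.ext hval

/-- `ω(h)` of the sub-model is `ω(h)` of `M`. -/
theorem kFiniteIncl_omg (h : G) (Φ : (M.kFinite ι).SK) :
    M.kFiniteIncl ι ((M.kFinite ι).omg h Φ) = M.omg h (M.kFiniteIncl ι Φ) := rfl

/-- The theta kernels of the sub-model are those of `M`. -/
theorem θ_kFinite (Φ : (M.kFinite ι).SK) : (M.kFinite ι).θ Φ = M.θ (M.kFiniteIncl ι Φ) := rfl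

/-- Every vector of the sub-model is `U(W_{i,b})`-finite in `M`. -/
theorem finiteDimensional_orbitSpan_kFiniteIncl (b : RealPl) (Φ : (M.kFinite ι).SK) :
    FiniteDimensional ℂ (orbitSpan M ι b (M.kFiniteIncl ι Φ)) :=
  (M.mem_finiteSK_iff ι (M.kFiniteIncl ι Φ)).mp Φ.2 b

/-- If `M` is already `U(W_{i,b})`-finite the construction changes nothing. -/
theorem finiteSK_eq_of_orbitFinite (h : OrbitFinite M ι) : M.finiteSK ι = M.SK :=
  Set.Subset.antisymm (M.finiteSK_subset ι) fun Φ hΦ => M.mem_finiteSK ι hΦ fun b => h b ⟨Φ, hΦ⟩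

/-- **Maximality**: any `S ⊆ 𝒮^κ` all of whose vectors are `U(W_{i,b})`-finite lies in `finiteSK` (so `M.kFinite ι`
is the largest sub-model on which `OrbitFinite` holds — `ω`-stability of `S` is not even needed). -/
theorem finiteSK_maximal {S : Set M.W.SX} (hS : S ⊆ M.SK)
    (hfin : ∀ (Φ : M.W.SX) (hΦ : Φ ∈ S) (b : RealPl), FiniteDimensional ℂ (orbitSpan M ι b ⟨Φ, hS hΦ⟩)) :
    S ⊆ M.finiteSK ι := fun Φ hΦ =>
  M.mem_finiteSK ι (hS hΦ) fun b => hfin Φ hΦ b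

end WeilThetaModel

/-! ## §3  `OrbitFinite` and N27 over the `K`-finite sub-model -/

namespace PerL34
namespace ArchAWeil

open ArchA

variable {GU : Type} [Group GU] [TopologicalSpace GU] [IsTopologicalGroup GU] {ΓU : Subgroup GU}
variable {G : Type} [CommGroup G] [TopologicalSpace G] [IsTopologicalGroup G] {Γ : Subgroup G}
variable (M : WeilThetaModel GU ΓU G Γ) {RealPl : Type} (ι : RealPl → (Circle →* G))

/-- The orbit spans of the sub-model are those of `M` (same kernels, same action). -/
theorem orbitSpan_kFinite (b : RealPl) (Φ : (M.kFinite ι).SK) :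
    orbitSpan (M.kFinite ι) ι b Φ = orbitSpan M ι b (M.kFiniteIncl ι Φ) := rfl

/-- **`OrbitFinite` HOLDS on the `K`-finite sub-model, by construction.** -/
theorem orbitFinite_kFinite : OrbitFinite (M.kFinite ι) ι := fun b Φ => by
  rw [orbitSpan_kFinite]
  exact M.finiteDimensional_orbitSpan_kFiniteIncl ι b Φ

/-- The kernel span of the sub-model sits inside that of `M`. -/
theorem kerSpan_kFinite_le : kerSpan (M.kFinite ι) ≤ kerSpan M := by
  rw [kerSpan]
  refine Submodule.span_le.mpr ?_
  rintro _ ⟨Φ, rfl⟩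
  exact θ_mem_kerSpan M (M.kFiniteIncl ι Φ)

variable [CompactSpace (GU ⧸ ΓU)] [CompactSpace (G ⧸ Γ)] [MeasurableSpace (G ⧸ Γ)] [BorelSpace (G ⧸ Γ)]
variable (ι₁ : RealPl) (kJ : RealPl → ℤ)

/-- `WeightDecomposition` ([BW] VIII 2.7(1)) over the `K`-finite sub-model, from continuity of `ι_b` ALONE. -/
theorem weightDecomposition_kFinite (hι : ∀ b, Continuous (ι b)) :
    (lineData (M.kFinite ι) ι₁ ι kJ).WeightDecomposition :=
  weightDecomposition_of_orbitFinite (M.kFinite ι) ι ι₁ kJ hι (orbitFinite_kFinite M ι)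

/-- **N27 = PerL v5 Lemma 4.1(a) over the `K`-finite part of ANY Weil theta model of a hermitian line**:
hypotheses = the model `M` (prl1-g4: [We64] n° 39 / Thm 6 BY NAME + class-U splitting), the DATA `ι` (real-place
circles, continuous), `ι₁`, `kJ` ([BW] weight names); conclusion = pv02's verbatim rendering `N27_statement` for the
line datum of `M.kFinite ι`.  NO finiteness / weight-decomposition hypothesis: it is built into the carrier, as in
print, where L4.1(a) is only ever applied to lifts of Fock = `K`-finite vectors (theta space, ll. 265–268; l. 264). -/
theorem N27_kFinite (hι : ∀ b, Continuous (ι b)) : (lineData (M.kFinite ι) ι₁ ι kJ).N27_statement :=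
  N27_ofWeilModel_finite (M.kFinite ι) ι ι₁ kJ hι (orbitFinite_kFinite M ι)

end ArchAWeil
end PerL34

end HodgeCM

end
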